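import Literature.AlgebraicGeometry.Motives.AbelianVarietyCotangent
import Literature.AlgebraicGeometry.Motives.AbelianVarietyTorsionCubeProofs
import Mathlib.AlgebraicGeometry.Morphisms.QuasiFinite
import Mathlib.RingTheory.QuasiFinite.Basic
import Mathlib.RingTheory.Ideal.Over
import HarnessLib

/-!
# The `[pⁿ]`-tower of ideals in the local ring of an abelian variety at the origin (characteristic `p`)

Topic `Literature/AlgebraicGeometry/Motives`; namespace `Literature.AlgebraicGeometry.Motives`.  THEOREMS ONLY (no definition, no named
fact, no instance, no notation, no `sorry`).  Cell `hodgecm-mathlib` (D-0151), P6b wave B, B2′ half (S3-β) «SPECIAL-FIBRE READING» (desk F0P6b-plan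
(g13) DEALS v5 (5); census `F0/P3b/LH6-p04/g14/s3b/CENSUS-S3beta-SpecialFibreReading.v1.LH6p04g14.md`): the geometric inputs of the ring-form
organ (S3-α) «a cofinal 𝔪-primary quotient tower of a regular local ring with coefficient field is presented by `k⟦X₁,…,X_g⟧`» on the road T1′
(«power-series presentation of the tower of unit components `𝒪(B[pⁿ]⁰)`», [Tate1967] §2.2 proof of Prop. 1, Messing-free).

Let `A` be an abelian variety over a field `K` with `(p : K) = 0`, `R := 𝒪_{A,e}` its local ring at the origin (★ `AbelianVariety.stalkOrigin`),
`𝔪 = 𝔪_e`, and for `N : ℕ` let `σ_N := [N]^♯ : R → R` be the stalk map of `[N]_A = N • 𝟙 A` at `e` (★ `AbelianVariety.stalkMapEnd`).  The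
tower of this file is `I n := 𝔪.map σ_{pⁿ}` — the ideal of `𝒪_{A,e}` generated by `[pⁿ]^♯ 𝔪_e`, i.e. the ideal cutting out the fibre
`[pⁿ]⁻¹(e) = A[pⁿ]` near `e`.  PROVED here:

* §1 (ring form, any commutative ring) `Ideal.map_le_pow_two_pow_of_tower` & co.: if `σ(𝔪) ⊆ 𝔪²` and `τ_{n+1} = τ_n ∘ σ`, `τ_0 = id`, then
  `n ↦ 𝔪.map τ_n` is antitone, `𝔪.map τ_n ⊆ 𝔪^(2^n)`, hence cofinal with the powers of `𝔪`.
* §2 (ring form, local rings) `exists_pow_maximalIdeal_le_map_of_quasiFinite`: for a QUASI-FINITE ring map `φ : T → S` of local rings with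
  `φ(𝔪_T) ⊆ 𝔪_S`, the ideal `𝔪_T S` is `𝔪_S`-primary: `𝔪_S^a ⊆ 𝔪_T S` for some `a` (`S ⧸ 𝔪_T S` is finite over the field `T ⧸ 𝔪_T`, hence Artinian,
  Mathlib `Algebra.QuasiFinite`).
* §3 (geometry) `map_maximalIdeal_stalkMapEnd_le_sq`: **`[p]^♯ 𝔪_e ⊆ 𝔪_e²`** when `p = 0` in `K` — «the cotangent map of `[p]` at `e` is `p = 0`», from ★
  `cotangentMap_zsmul_id_holds` («`Lie([n]_A) = n`», [GortzWedhorn2023] Rem. 27.18 (3) and proof of Prop. 27.187); `antitone_torsionStalkIdeal`,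
  `torsionStalkIdeal_le_pow_two_pow`, `exists_torsionStalkIdeal_le_pow` (cofinality); **`exists_pow_maximalIdeal_le_map_stalkMapEnd`**: `𝔪_e^a ⊆ 𝔪.map σ_N`
  for `N ≠ 0` — `[N]_A` is an isogeny (★ `isIsogeny_zsmul_id_holds`, [GortzWedhorn2023] Prop. 27.186), hence finite, hence quasi-finite at `e` (Mathlib
  `Scheme.Hom.quasiFiniteAt`), and §2 applies to its stalk map.
* HEAD `exists_stalkOrigin_torsionTower_package`: the seven facts (S3-α) consumes, by name — `𝒪_{A,e}` regular (★ `isRegularLocalRing_stalk`) of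
  dimension `dim A` (★ `ringKrullDim_stalkOrigin`) with coefficient map `K → 𝒪_{A,e}` onto the residue field (★ `exists_sub_algebraMap_mem_maximalIdeal`),
  and the tower `I` antitone, 𝔪-primary, `≤ 𝔪^(2^n)`, cofinal.

HONEST LABEL: count-neutral organ of the P6b sub-line (hLiu418 = stmt-HodgeConjecture-24832 side); HC_CM is proved only modulo the printed
citations (2 remaining named inputs hLiu418, h413) until rung 0 closes.

## References
* [GortzWedhorn2023] U. Görtz, T. Wedhorn, *Algebraic Geometry II* (2023): Remark 27.18 (3), Prop. 27.186 (p. 674) and proof of Prop. 27.187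
  (pp. 674–675), Cor. 27.177.
* [GortzWedhorn2020] U. Görtz, T. Wedhorn, *Algebraic Geometry I*, 2nd ed. (2020): Definition 6.2, Lemma 6.26.
* [Tate1967] J. T. Tate, *p-divisible groups*, Proc. Conf. Local Fields (Driebergen 1966), Springer 1967: §2.2, proof of Prop. 1.
* [StacksProject] Tag 00PL (quasi-finite algebras).
-/

set_option autoImplicit false

noncomputable section

universe u

open CategoryTheory AlgebraicGeometry IsLocalRing

namespace Literature.AlgebraicGeometry.Motives

/-! ## §1 Ring form: an endomorphism contracting `𝔪` into `𝔪²` makes the iterate tower cofinal with the `𝔪`-adic one -/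

section IterateTower

variable {R : Type*} [CommRing R]

/-- If `σ(𝔪) ⊆ 𝔪²` then `σ(𝔪^j) ⊆ 𝔪^{2j}` (`σ(𝔪^j) = σ(𝔪)^j`) — the one-step form of «`d[p]_e = 0` ⇒ the `[pⁿ]`-fibres shrink
𝔪-adically». [cite: Tate1967, §2.2 (proof of Prop. 1)] -/
theorem Ideal.map_pow_le_pow_two_mul (σ : R →+* R) {M : Ideal R} (hσ : M.map σ ≤ M ^ 2) (j : ℕ) :
    (M ^ j).map σ ≤ M ^ (2 * j) := by
  rw [Ideal.map_pow, pow_mul]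
  exact Ideal.pow_right_mono hσ j

variable {σ : R →+* R} {M : Ideal R} {τ : ℕ → R →+* R}

/-- **Cofinality of the iterate tower.**  If `σ(𝔪) ⊆ 𝔪²`, `τ_0 = id` and `τ_{n+1} = τ_n ∘ σ`, then `τ_n(𝔪) R ⊆ 𝔪^(2^n)`: by induction,
`τ_{n+1}(𝔪) R = τ_n(σ(𝔪) R) R ⊆ τ_n(𝔪²) R = (τ_n(𝔪) R)² ⊆ (𝔪^(2^n))²`.  (The shape of «`d[p]_e = 0` ⇒ the `[pⁿ]`-fibres shrink 𝔪-adically»,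
[Tate1967] §2.2.) [cite: Tate1967, §2.2 (proof of Prop. 1)] -/
theorem Ideal.map_le_pow_two_pow_of_tower (hσ : M.map σ ≤ M ^ 2) (h0 : τ 0 = RingHom.id R)
    (hsucc : ∀ n, τ (n + 1) = (τ n).comp σ) (n : ℕ) : M.map (τ n) ≤ M ^ 2 ^ n := by
  induction n with
  | zero => rw [h0, Ideal.map_id, pow_zero, pow_one]
  | succ n ih =>
    rw [hsucc n, ← Ideal.map_map]
    calc (M.map σ).map (τ n) ≤ (M ^ 2).map (τ n) := Ideal.map_mono hσ
      _ = (M.map (τ n)) ^ 2 := Ideal.map_pow _ _ _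
      _ ≤ (M ^ 2 ^ n) ^ 2 := Ideal.pow_right_mono ih 2
      _ = M ^ 2 ^ (n + 1) := by rw [← pow_mul, pow_succ]

/-- The iterate tower is antitone: `τ_{n+1}(𝔪) R = τ_n(σ(𝔪) R) R ⊆ τ_n(𝔪) R` since `σ(𝔪) ⊆ 𝔪² ⊆ 𝔪` (the inclusions
`A[pⁿ] ⊆ A[p^{n+1}]` read on the defining ideals at `e`). [cite: Tate1967, §2.2 (proof of Prop. 1)] -/
theorem Ideal.antitone_map_of_tower (hσ : M.map σ ≤ M ^ 2) (hsucc : ∀ n, τ (n + 1) = (τ n).comp σ) :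
    Antitone fun n => M.map (τ n) := by
  refine antitone_nat_of_succ_le fun n => ?_
  rw [hsucc n, ← Ideal.map_map]
  exact Ideal.map_mono (hσ.trans (Ideal.pow_le_self two_ne_zero))

/-- Cofinality with the `𝔪`-adic filtration: every power `𝔪^b` contains some `τ_n(𝔪) R` (namely `n = b`, as `b ≤ 2^b`).
[cite: Tate1967, §2.2 (proof of Prop. 1)] -/
theorem Ideal.exists_map_le_pow_of_tower (hσ : M.map σ ≤ M ^ 2) (h0 : τ 0 = RingHom.id R)
    (hsucc : ∀ n, τ (n + 1) = (τ n).comp σ) (b : ℕ) : ∃ n, M.map (τ n) ≤ M ^ b :=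
  ⟨b, (Ideal.map_le_pow_two_pow_of_tower hσ h0 hsucc b).trans (Ideal.pow_le_pow_right b.lt_two_pow_self.le)⟩

end IterateTower

/-! ## §2 Ring form: the maximal ideal of the source generates an 𝔪-primary ideal along a quasi-finite local map -/

section QuasiFinitePrimary

variable {T S : Type*} [CommRing T] [CommRing S] [IsLocalRing T] [IsLocalRing S]

/-- **`𝔪_T S` is `𝔪_S`-primary for a quasi-finite local map `φ : T → S` of local rings**: `S ⧸ 𝔪_T S` is quasi-finite over `T`
(Mathlib `Algebra.QuasiFinite`, stable under quotients), hence over the residue FIELD `T ⧸ 𝔪_T`, hence a finite `T ⧸ 𝔪_T`-module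
(`Module.Finite.of_quasiFinite` over an Artinian base), hence an Artinian ring; its Jacobson radical — the image of `𝔪_S`, the only maximal
ideal above the proper ideal `𝔪_T S ⊆ 𝔪_S` — is therefore nilpotent: `𝔪_S^a ⊆ 𝔪_T S`.  [cite: StacksProject, Tag 00PL] -/
theorem exists_pow_maximalIdeal_le_map_of_quasiFinite {φ : T →+* S} (hφ : φ.QuasiFinite)
    (hle : (maximalIdeal T).map φ ≤ maximalIdeal S) :
    ∃ a, maximalIdeal S ^ a ≤ (maximalIdeal T).map φ := by
  algebraize [φ]
  set I : Ideal S := (maximalIdeal T).map (algebraMap T S) with hI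
  have hItop : I ≠ ⊤ := fun h => (maximalIdeal.isMaximal S).ne_top (top_le_iff.mp (h ▸ hle))
  haveI : Algebra.QuasiFinite (T ⧸ maximalIdeal T) (S ⧸ I) :=
    Algebra.QuasiFinite.of_restrictScalars (R := T) (S := T ⧸ maximalIdeal T) (T := S ⧸ I)
  letI : Field (T ⧸ maximalIdeal T) := Ideal.Quotient.field (maximalIdeal T)
  haveI : Module.Finite (T ⧸ maximalIdeal T) (S ⧸ I) := Module.Finite.of_quasiFinite
  haveI : IsArtinianRing (S ⧸ I) := IsArtinianRing.of_finite (T ⧸ maximalIdeal T) (S ⧸ I)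
  obtain ⟨a, ha⟩ := IsArtinianRing.isNilpotent_jacobson_bot (R := S ⧸ I)
  have hjac : (maximalIdeal S).map (Ideal.Quotient.mk I) = Ideal.jacobson (⊥ : Ideal (S ⧸ I)) := by
    rw [← IsLocalRing.jacobson_eq_maximalIdeal I hItop,
      Ideal.map_jacobson_of_surjective Ideal.Quotient.mk_surjective Ideal.mk_ker.le,
      Ideal.map_quotient_self]
  refine ⟨a, ?_⟩
  have h : (maximalIdeal S ^ a).map (Ideal.Quotient.mk I) = ⊥ := by
    rw [Ideal.map_pow, hjac, ha, Ideal.zero_eq_bot]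
  rwa [Ideal.map_eq_bot_iff_le_ker, Ideal.mk_ker] at h

end QuasiFinitePrimary

/-! ## §3 Geometry: the `[pⁿ]`-tower in `𝒪_{A,e}` -/

namespace AbelianVariety

open scoped MonObj

variable {K : Type u} [Field K] (A : AbelianVariety K)

/-- **`[p]^♯ a ∈ 𝔪_e²` for `a ∈ 𝔪_e` when `p = 0` in `K`**: «the cotangent map of `[p]_A` at `e` is multiplication by `p`, i.e. zero» —
★ `cotangentMap_zsmul_id_holds` (`[n]^♯ a − n·a ∈ 𝔪_e²`) with `n·a = (p : K)·a = 0`. [cite: GortzWedhorn2023, Remark 27.18 (3) and proof of Prop. 27.187] -/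
theorem stalkMapEnd_natCast_zsmul_id_mem_sq {p : ℕ} (hpk : (p : K) = 0) {a : stalkOrigin A}
    (ha : a ∈ maximalIdeal (stalkOrigin A)) :
    stalkMapEnd A ((p : ℤ) • 𝟙 A) a ∈ maximalIdeal (stalkOrigin A) ^ 2 := by
  have h := cotangentScalar_zsmul_id (cotangentMap_zsmul_id_holds (A := A)) (p : ℤ) a ha
  have h0 : stalkOriginAlgebraMap A ((p : ℤ) : K) = 0 := by rw [Int.cast_natCast, hpk, map_zero]
  rwa [h0, zero_mul, sub_zero] at h

/-- **`[p]^♯ 𝔪_e ⊆ 𝔪_e²`** (ideal form of `stalkMapEnd_natCast_zsmul_id_mem_sq`). [cite: GortzWedhorn2023, Remark 27.18 (3)] -/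
theorem map_maximalIdeal_stalkMapEnd_le_sq {p : ℕ} (hpk : (p : K) = 0) :
    (maximalIdeal (stalkOrigin A)).map (stalkMapEnd A ((p : ℤ) • 𝟙 A)).hom ≤ maximalIdeal (stalkOrigin A) ^ 2 := by
  rw [Ideal.map_le_iff_le_comap]
  intro a ha
  exact A.stalkMapEnd_natCast_zsmul_id_mem_sq hpk ha

/-- `ℕ`- versus `ℤ`-scalar spelling of `[N]_A`: `stalkMapEnd A ((N : ℤ) • 𝟙 A) = stalkMapEnd A (N • 𝟙 A)` (for consumers working with
`N • 𝟙` ∕ ★ `AbelianSchemeOver.mulN`, cf. ★ `nsmul_id_hom_eq_mulN`; `[N]_X = N • 𝟙 X` as in Görtz–Wedhorn II, Rem. 27.18 (3)).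
[cite: GortzWedhorn2023, Remark 27.18 (3)] -/
theorem stalkMapEnd_natCast_zsmul_id (N : ℕ) : stalkMapEnd A ((N : ℤ) • 𝟙 A) = stalkMapEnd A (N • 𝟙 A) := by
  rw [natCast_zsmul]

/-- `[p⁰]^♯ = [1]^♯ = id` on `𝒪_{A,e}` (functoriality of `f ↦ f_x^♯`, Görtz–Wedhorn I, Remark 6.3 (3)). [cite: GortzWedhorn2020, Remark 6.3 (3)] -/
theorem stalkMapEnd_pow_zero_hom (p : ℕ) :
    (stalkMapEnd A (((p ^ 0 : ℕ) : ℤ) • 𝟙 A)).hom = RingHom.id (stalkOrigin A) := by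
  rw [pow_zero, Nat.cast_one, one_zsmul, stalkMapEnd_id]
  rfl

/-- `[p^{n+1}]^♯ = [pⁿ]^♯ ∘ [p]^♯` on `𝒪_{A,e}` (`[p^{n+1}] = [p] ∘ [pⁿ]` and contravariance of `u ↦ u^♯`, ★ `stalkMapEnd_comp`; Görtz–Wedhorn I,
Remark 6.3 (3): «compatible with composition of morphisms»). [cite: GortzWedhorn2020, Remark 6.3 (3)] -/
theorem stalkMapEnd_pow_succ_hom (p n : ℕ) :
    (stalkMapEnd A (((p ^ (n + 1) : ℕ) : ℤ) • 𝟙 A)).hom =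
      (stalkMapEnd A (((p ^ n : ℕ) : ℤ) • 𝟙 A)).hom.comp (stalkMapEnd A ((p : ℤ) • 𝟙 A)).hom := by
  have hcomp : (((p ^ n : ℕ) : ℤ) • 𝟙 A) ≫ ((p : ℤ) • 𝟙 A) = ((p ^ (n + 1) : ℕ) : ℤ) • 𝟙 A := by
    rw [Preadditive.zsmul_comp, Preadditive.comp_zsmul, Category.id_comp, smul_smul, ← Nat.cast_mul, ← pow_succ]
  rw [← hcomp, stalkMapEnd_comp, CommRingCat.hom_comp]

/-- The `[pⁿ]`-tower `n ↦ [pⁿ]^♯ 𝔪_e · 𝒪_{A,e}` is ANTITONE. [cite: Tate1967, §2.2 (proof of Prop. 1)] -/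
theorem antitone_torsionStalkIdeal {p : ℕ} (hpk : (p : K) = 0) :
    Antitone fun n : ℕ => (maximalIdeal (stalkOrigin A)).map (stalkMapEnd A (((p ^ n : ℕ) : ℤ) • 𝟙 A)).hom :=
  Ideal.antitone_map_of_tower (τ := fun n => (stalkMapEnd A (((p ^ n : ℕ) : ℤ) • 𝟙 A)).hom)
    (A.map_maximalIdeal_stalkMapEnd_le_sq hpk) (A.stalkMapEnd_pow_succ_hom p)

/-- **`[pⁿ]^♯ 𝔪_e · 𝒪_{A,e} ⊆ 𝔪_e^(2^n)`** in characteristic `p`. [cite: Tate1967, §2.2 (proof of Prop. 1)] [cite: GortzWedhorn2023, Remark 27.18 (3)] -/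
theorem torsionStalkIdeal_le_pow_two_pow {p : ℕ} (hpk : (p : K) = 0) (n : ℕ) :
    (maximalIdeal (stalkOrigin A)).map (stalkMapEnd A (((p ^ n : ℕ) : ℤ) • 𝟙 A)).hom ≤ maximalIdeal (stalkOrigin A) ^ 2 ^ n :=
  Ideal.map_le_pow_two_pow_of_tower (τ := fun n => (stalkMapEnd A (((p ^ n : ℕ) : ℤ) • 𝟙 A)).hom)
    (A.map_maximalIdeal_stalkMapEnd_le_sq hpk) (A.stalkMapEnd_pow_zero_hom p) (A.stalkMapEnd_pow_succ_hom p) n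

/-- The `[pⁿ]`-tower is COFINAL with the `𝔪_e`-adic filtration. [cite: Tate1967, §2.2 (proof of Prop. 1)] -/
theorem exists_torsionStalkIdeal_le_pow {p : ℕ} (hpk : (p : K) = 0) (b : ℕ) :
    ∃ n : ℕ, (maximalIdeal (stalkOrigin A)).map (stalkMapEnd A (((p ^ n : ℕ) : ℤ) • 𝟙 A)).hom ≤ maximalIdeal (stalkOrigin A) ^ b :=
  Ideal.exists_map_le_pow_of_tower (τ := fun n => (stalkMapEnd A (((p ^ n : ℕ) : ℤ) • 𝟙 A)).hom)
    (A.map_maximalIdeal_stalkMapEnd_le_sq hpk) (A.stalkMapEnd_pow_zero_hom p) (A.stalkMapEnd_pow_succ_hom p) b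

/-- **`[N]^♯ 𝔪_e · 𝒪_{A,e}` is `𝔪_e`-primary for `N ≠ 0`**: `[N]_A` is an isogeny (★ `isIsogeny_zsmul_id_holds`), in particular FINITE, hence
quasi-finite at the origin (Mathlib `Scheme.Hom.quasiFiniteAt`: the stalk map `𝒪_{A,[N]e} → 𝒪_{A,e}` is quasi-finite), and §2 applies; the
transport `𝒪_{A,[N]e} ≅ 𝒪_{A,e}` along `[N] e = e` (inside ★ `stalkMapEnd`) maps maximal ideal onto maximal ideal.
[cite: GortzWedhorn2023, Prop. 27.186 (p. 674) and Cor. 27.177 (1)] [cite: StacksProject, Tag 00PL] -/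
theorem exists_pow_maximalIdeal_le_map_stalkMapEnd {N : ℕ} (hN : N ≠ 0) :
    ∃ a, maximalIdeal (stalkOrigin A) ^ a ≤ (maximalIdeal (stalkOrigin A)).map (stalkMapEnd A ((N : ℤ) • 𝟙 A)).hom := by
  set u : A ⟶ A := (N : ℤ) • 𝟙 A with hu
  have hiso : IsIsogeny u := isIsogeny_zsmul_id_holds A (N : ℤ) (by exact_mod_cast hN)
  haveI : IsFinite (Hom.toSchemeHom u) := hiso.2
  have hq : (Hom.toSchemeHom u).QuasiFiniteAt (origin A) := (Hom.toSchemeHom u).quasiFiniteAt (origin A)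
  have hle : (maximalIdeal (A.X.left.presheaf.stalk ((Hom.toSchemeHom u).base (origin A)))).map
      ((Hom.toSchemeHom u).stalkMap (origin A)).hom ≤ maximalIdeal (stalkOrigin A) :=
    Ideal.map_le_iff_le_comap.mpr fun x hx => map_nonunit ((Hom.toSchemeHom u).stalkMap (origin A)).hom x hx
  obtain ⟨a, ha⟩ := exists_pow_maximalIdeal_le_map_of_quasiFinite hq hle
  refine ⟨a, ha.trans ?_⟩
  rw [stalkMapEnd, CommRingCat.hom_comp, ← Ideal.map_map]
  refine Ideal.map_mono fun y hy => ?_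
  set c := A.X.left.presheaf.stalkCongr (.of_eq (toSchemeHom_origin u)) with hc
  have hy' : y = c.inv.hom (c.hom.hom y) := by
    rw [← CommRingCat.comp_apply, Iso.hom_inv_id, CommRingCat.id_apply]
  have hmem : c.hom.hom y ∈ maximalIdeal (stalkOrigin A) := by
    rw [IsLocalRing.mem_maximalIdeal, mem_nonunits_iff] at hy ⊢
    intro hunit
    apply hy
    have h2 := hunit.map c.inv.hom
    rwa [← hy'] at h2
  rw [hy']
  exact Ideal.mem_map_of_mem _ hmem

/-- **HEAD — the (S3-β) package for the ring-form organ (S3-α).**  For an abelian variety `A` over a field `K` with `(p : K) = 0`, `p ≠ 0`: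
with `R := 𝒪_{A,e}` and `I n := [pⁿ]^♯ 𝔪_e · R`, (1) `R` is a regular local ring, (2) `dim R = dim A`, (3) `K → R` maps onto the residue field
(`R = K + 𝔪`), (4) `I` is antitone, (5) every `I n` is 𝔪-primary, (6) `I n ⊆ 𝔪^(2^n)`, (7) `I` is cofinal with the powers of `𝔪` — so that
(S3-α) presents the tower `R ⧸ I n = 𝒪_{A[pⁿ], e}` by compatible surjections from `K⟦X₁,…,X_{dim A}⟧` with zero joint kernel ([Tate1967] §2.2:
«one is reduced by standard procedures to the case in which `R = k`», done here by algebraization instead of `F`∕`V`).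
[cite: Tate1967, §2.2 (proof of Prop. 1)] [cite: GortzWedhorn2020, Lemma 6.26 (p. 196)] [cite: GortzWedhorn2023, Remark 27.18 (3) and Prop. 27.186] -/
theorem exists_stalkOrigin_torsionTower_package {p : ℕ} (hp : p ≠ 0) (hpk : (p : K) = 0) :
    IsRegularLocalRing (stalkOrigin A) ∧ ringKrullDim (stalkOrigin A) = A.dim ∧
      (∀ r : stalkOrigin A, ∃ c : K, r - stalkOriginAlgebraMap A c ∈ maximalIdeal (stalkOrigin A)) ∧
      (Antitone fun n : ℕ => (maximalIdeal (stalkOrigin A)).map (stalkMapEnd A (((p ^ n : ℕ) : ℤ) • 𝟙 A)).hom) ∧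
      (∀ n : ℕ, ∃ a, maximalIdeal (stalkOrigin A) ^ a ≤
        (maximalIdeal (stalkOrigin A)).map (stalkMapEnd A (((p ^ n : ℕ) : ℤ) • 𝟙 A)).hom) ∧
      (∀ n : ℕ, (maximalIdeal (stalkOrigin A)).map (stalkMapEnd A (((p ^ n : ℕ) : ℤ) • 𝟙 A)).hom ≤
        maximalIdeal (stalkOrigin A) ^ 2 ^ n) ∧
      (∀ b : ℕ, ∃ n : ℕ, (maximalIdeal (stalkOrigin A)).map (stalkMapEnd A (((p ^ n : ℕ) : ℤ) • 𝟙 A)).hom ≤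
        maximalIdeal (stalkOrigin A) ^ b) :=
  ⟨A.isRegularLocalRing_stalk (origin A), ringKrullDim_stalkOrigin A, exists_sub_algebraMap_mem_maximalIdeal A,
    A.antitone_torsionStalkIdeal hpk, fun n => A.exists_pow_maximalIdeal_le_map_stalkMapEnd (pow_ne_zero n hp),
    A.torsionStalkIdeal_le_pow_two_pow hpk, A.exists_torsionStalkIdeal_le_pow hpk⟩

end AbelianVariety

end Literature.AlgebraicGeometry.Motives

end
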